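import Literature.Geometry.Kaehler.ComplexTorusAbelianSurfaceComplexMultiplicationHodgeEqLefschetz
import Literature.Geometry.Kaehler.ComplexTorusAbelianSurfaceTimesEllipticCurveHodgeGroup
import Literature.Geometry.Kaehler.ComplexTorusHodgeLieAlgebraComplexStableSubspaces
import Literature.Geometry.Kaehler.ComplexTorusHodgeGroupProductKernelsRational
import Literature.Geometry.Kaehler.ComplexTorusMumfordTateGroupDefinedOverQ
import Literature.Geometry.Kaehler.ComplexTorusHodgeGroupLieAlgebraAlgebraic
import Literature.Geometry.Kaehler.ComplexTorusRosatiCM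
import Literature.NumberTheory.Automorphic.LieAlgebraGLExponential
import Literature.FieldTheory.AlgClosed.AutomorphismExtension
import Literature.FieldTheory.AlgClosed.AutFixedSubfield
import Mathlib.LinearAlgebra.Countable
import HarnessLib

/-!
# The eigenframe of a simple complex abelian surface with complex multiplication: `Hg(Y)(ℂ) = P 𝕋_π P⁻¹`,
# `Lie Hg(Y)(ℂ) = {P diag(z) P⁻¹ | z ∘ π = -z}`, `J = P diag(i s) P⁻¹`, `Aut(ℂ)` permutes the eigenlines, and
# SOME automorphism of `ℂ` induces the 4-CYCLE `j₀ ↦ j₀' ↦ π j₀ ↦ π j₀'` (Moonen–Zarhin 1999 §4 (4.1): the quartic CM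
# field of a simple CM surface contains no imaginary quadratic field)

Layer `Literature/Geometry/Kaehler`, namespace `Literature.Geometry.Kaehler.ComplexTorus`; lane `lit-hodgefound` (Track 2
foundations library), Layer A3∕A4; prover seat `lit-hodgefound-p17` (generation 53, self-proposed row g53-#2).  THEOREMS ONLY (no
definition, no instance, no notation, no named fact; D-0026 net debt 0).  The consumer is g53-#3
(`ComplexTorusSimpleCMSurfacesProductHodgeGroup`: Moonen–Zarhin Prop. (4.2), `Hg(Y₁ × Y₂) = Hg(Y₁) × Hg(Y₂)` for two
non-isogenous simple CM surfaces), which feeds the data below into the pure linear-algebra dichotomy of g53-#1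
(`Literature/LinearAlgebra/CMSurfacePairCocharacterDichotomy`).

DICTIONARY.  `Y = E ∕ Ψ(ℤ^κ)` a simple polarised complex abelian surface (`IsSimple Ψ`, `IsRiemannForm Ψ η`, `dim_ℂ E = 2`, so
`#κ = 4`) with COMMUTATIVE Hodge group (CM type: `End⁰(Y) = F` a quartic CM field, `Hg(Y) = U_F`, Moonen–Zarhin (2.2) IV(2,1), the
tree's `ComplexTorusAbelianSurfaceComplexMultiplicationHodgeEqLefschetz`).  `P ∈ GL₄(ℂ)` is a common eigenbasis of
`End⁰(Y) ⊗ ℂ` (columns = the four eigenlines `V_j`, `j ∈ κ`), `π` the fixed-point-free involution of `κ` pairing `V_j` with the only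
line not `E`-orthogonal to it, `𝕋_π = {diag(d) | d_{π j} d_j = 1}` (the tree's `pairedDiagTorus`; `ComplexTorusCMLefschetzGroupConnected`:
`S(Y)(ℂ) = P 𝕋_π P⁻¹`).  The character of the line `j` is `χ_j : F → ℂ`, `A ⊗ 1 = P diag(χ_•(A)) P⁻¹`.

## Sources, verbatim

* B. Moonen, Yu. G. Zarhin [MoonenZarhin1999LowDim], held `paper:arxiv-math_9901113`: §2 (2.2) `g = 2` (p0005 L77–L78) «Type IV(2,1):
  `End⁰(X) = F` is a quartic CM-field not containing an imaginary quadratic subfield. We have `Hg(X) = U_F`»; §4 (4.1) (p0008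
  L1–L7) «let `F` be a quartic CM-field which does not contain an imaginary quadratic subfield. Then either (1) `F` is Galois over
  `ℚ`, in which case `Aut(F)` is cyclic of order 4 acting transitively on `Γ_F`, or (2) `F` is not Galois over `ℚ`, its normal closure
  `L` has degree 8 over `ℚ`, and `Aut(F) = {id, ι}`»; Prop. (4.2) and its proof (p0008 L11–L65: «the torus `U_F` is `ℚ`-simple. Its
  splitting field is the field `L`»; «`Gal(L/ℚ) ≅ D₄`»).
* G. Shimura [Shimura1998], *Abelian Varieties with Complex Multiplication and Modular Functions*, §5.1 Lemma 2, Prop. 5–6 (the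
  Rosati involution restricts to complex conjugation on the CM centre), §8.4 Prop. 14 and 18 (as quoted by Moonen–Zarhin: «the
  CM-field `F` does not contain an imaginary quadratic field»).
* A. Borel [Borel1991], *Linear Algebraic Groups*, §8.11 (the `Γ`-action on `X*(T)` of an `F`-torus), AG §14.
* T. A. Springer [Springer1998], *Linear Algebraic Groups*, 2nd ed., 3.2.10 (4), 4.4.13, 13.1.1.

## What is proved

* §0 plumbing (private): four points, `σ`-stability of the complex span of rational matrices, algebra in a fixed frame `P`.
* §1 **`exists_perm_forall_map_conj_diagonal`** — if `σ ∈ Aut(ℂ)` carries the algebra `𝒯 = {P diag(c) P⁻¹}` into itself, it acts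
  on it through a PERMUTATION `g` of the eigenlines: `σ(P diag(z) P⁻¹) = P diag(σ ∘ z ∘ g) P⁻¹` (the minimal idempotents of
  `ℂ^κ` are permuted).
* §2 **`exists_ringEquiv_fourCycle_of_forall_sq_ne`** — pure field theory (the content of Moonen–Zarhin (4.1)): for an injective
  family of four complex embeddings `χ_j` of a number field `K` with a conjugation `τ` (`χ_j ∘ τ = conj ∘ χ_j`, `τ ≠ id`), paired by
  `π` (`χ_{π j} = conj ∘ χ_j`), such that every `σ ∈ Aut(ℂ)` permutes the `χ_j`, and `K` contains NO `w` with `w² = r < 0`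
  (no imaginary quadratic subfield), some `σ` acts on a CM type `{j₁, j₂}` as the 4-cycle `j₁ ↦ j₂ ↦ π j₁` (up to relabelling);
  otherwise the permutation image is the Klein four-group `{e, π, κ, πκ}` and `χ_{j₁}(a - τ a) ± χ_{j₂}(a - τ a)` is an element of
  `χ_{j₁}(K)` with negative rational square.
* §3 **`IsSimple.exists_cmEigenframe_of_hodgeGroup_comm_of_finrank_eq_two`** — THE EIGENFRAME of a simple CM surface: `π`, `P`, a
  sign vector `s`, with (a) `Hg(Y)(ℂ) = P 𝕋_π P⁻¹`, (b) `P diag(z) P⁻¹ ∈ Lie Hg(Y)(ℂ) ⟺ z ∘ π = -z`, (c) every element of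
  `Lie Hg(Y)(ℂ)` is a `P diag(z) P⁻¹`, (d) `s = ±1`, `s ∘ π = -s`, `J ⊗ 1 = P diag(i s) P⁻¹`, (e) every `σ ∈ Aut(ℂ)` acts by a line
  permutation commuting with `π`, (f) the 4-cycle, (g) `#κ = 4`.

## Deviation from the print (recorded)

Moonen–Zarhin phrase (4.1)–(4.2) through CM types `Φ ⊂ Σ_F`, the Galois closure `L` and `Gal(L/ℚ) ∈ {C₄, D₄}`; here the same
dichotomy is read on the `Aut(ℂ)`-permutations of the four eigenlines of `End⁰(Y) ⊗ ℂ` (the embeddings `χ_j`), and «`F` does not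
contain an imaginary quadratic field» enters as the tree's `IsSimple.sq_ne_algebraMap_of_neg_of_finrank_eq_two` (g51): if no
automorphism induced a 4-cycle, the induced permutations would form the Klein four-group and `F` would contain an element of
negative rational square.
-/

noncomputable section

open Matrix Module Function Cardinal
open scoped MatrixGroups ComplexConjugate

namespace Literature.Geometry.Kaehler

namespace ComplexTorus

open Literature.NumberTheory.Automorphic (IsZConnected IsAlgebraicSubgroup lieAlgebraGL exp_smul_diagonal
  exists_mem_coe_eq_exp_smul_of_mem_lieAlgebraGL mem_lieAlgebraGL_of_forall_exp_smul_mem)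
open Literature.FieldTheory.AlgClosed (exists_ringEquiv_apply_eq Complex.mem_subfield_of_forall_ringEquiv)

/-! ### §0 Plumbing (file-local) -/

section Plumbing

variable {ι : Type*} [Fintype ι] [DecidableEq ι]

omit [Fintype ι] [DecidableEq ι] in
/-- Four points: a fixed-point-free involution `π` and a CM type `{j₁, j₂}` (`j₂ ≠ j₁, π j₁`) on a 4-set. [folklore] -/
private theorem four_points₅₃ [Fintype ι] [DecidableEq ι] (hcard : Fintype.card ι = 4) {π : ι → ι} (hπ : Involutive π)
    (hπ' : ∀ j, π j ≠ j) {j₁ j₂ : ι} (h12 : j₁ ≠ j₂) (h12' : j₂ ≠ π j₁) :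
    (π j₂ ≠ j₁ ∧ π j₁ ≠ π j₂) ∧ ∀ j, j = j₁ ∨ j = j₂ ∨ j = π j₁ ∨ j = π j₂ := by
  have h3 : π j₂ ≠ j₁ := fun h ↦ h12' (by rw [← h, hπ j₂])
  have h5 : π j₁ ≠ π j₂ := fun h ↦ h12 (hπ.injective h)
  refine ⟨⟨h3, h5⟩, fun j ↦ ?_⟩
  have hS : ({j₁, j₂, π j₁, π j₂} : Finset ι) = Finset.univ := by
    apply Finset.eq_univ_of_card
    have hc : ({j₁, j₂, π j₁, π j₂} : Finset ι).card = 4 := by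
      rw [Finset.card_insert_of_notMem (by simp [h12, (hπ' j₁).symm, h3.symm]),
        Finset.card_insert_of_notMem (by simp [(hπ' j₂).symm, h12']),
        Finset.card_insert_of_notMem (by simp [h5]), Finset.card_singleton]
    rw [hc, hcard]
  have hj' := Finset.mem_univ j
  rw [← hS] at hj'
  simpa only [Finset.mem_insert, Finset.mem_singleton] using hj'

omit [Fintype ι] [DecidableEq ι] in
/-- `σ` fixes rational matrices: `σ(A ⊗ 1) = A ⊗ 1`. [folklore] -/
private theorem map_algebraMap_map_ringEquiv₅₃ (σ : ℂ ≃+* ℂ) (A : Matrix ι ι ℚ) :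
    (A.map (algebraMap ℚ ℂ)).map σ = A.map (algebraMap ℚ ℂ) := by
  ext i j
  simp [Matrix.map_apply]

omit [Fintype ι] [DecidableEq ι] in
/-- The complex span of a set of rational matrices is stable under the entrywise action of `Aut(ℂ)`. [folklore] -/
private theorem map_ringEquiv_mem_span₅₃ (σ : ℂ ≃+* ℂ) (R : Set (Matrix ι ι ℚ)) {Z : Matrix ι ι ℂ}
    (hZ : Z ∈ Submodule.span ℂ ((fun A : Matrix ι ι ℚ ↦ A.map (algebraMap ℚ ℂ)) '' R)) :
    Z.map σ ∈ Submodule.span ℂ ((fun A : Matrix ι ι ℚ ↦ A.map (algebraMap ℚ ℂ)) '' R) := by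
  induction hZ using Submodule.span_induction with
  | mem Y hY =>
    obtain ⟨A, hA, rfl⟩ := hY
    rw [map_algebraMap_map_ringEquiv₅₃]
    exact Submodule.subset_span ⟨A, hA, rfl⟩
  | zero =>
    rw [Matrix.map_zero _ (map_zero σ)]
    exact zero_mem _
  | add Y Y' _ _ hY hY' =>
    rw [Matrix.map_add _ (map_add σ)]
    exact add_mem hY hY'
  | smul c Y _ hY =>
    have h : (c • Y).map (σ : ℂ → ℂ) = σ c • Y.map σ := by
      ext i j
      simp [Matrix.map_apply]
    rw [h]
    exact Submodule.smul_mem _ _ hY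

variable {P : Matrix ι ι ℂ}

/-- `P⁻¹ (P X P⁻¹) P = X`. [folklore] -/
private theorem inv_mul_conj_mul₅₃ (hP : IsUnit P.det) (X : Matrix ι ι ℂ) : P⁻¹ * (P * X * P⁻¹) * P = X := by
  rw [show P⁻¹ * (P * X * P⁻¹) * P = P⁻¹ * P * X * (P⁻¹ * P) by simp only [Matrix.mul_assoc],
    Matrix.nonsing_inv_mul _ hP, Matrix.one_mul, Matrix.mul_one]

/-- `P (P⁻¹ X P) P⁻¹ = X`. [folklore] -/
private theorem mul_inv_conj_inv₅₃ (hP : IsUnit P.det) (X : Matrix ι ι ℂ) : P * (P⁻¹ * X * P) * P⁻¹ = X := by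
  rw [show P * (P⁻¹ * X * P) * P⁻¹ = P * P⁻¹ * X * (P * P⁻¹) by simp only [Matrix.mul_assoc],
    Matrix.mul_nonsing_inv _ hP, Matrix.one_mul, Matrix.mul_one]

/-- Conjugates of diagonal matrices multiply diagonally. [folklore] -/
private theorem conjDiag_mul₅₃ (hP : IsUnit P.det) (c c' : ι → ℂ) :
    P * diagonal c * P⁻¹ * (P * diagonal c' * P⁻¹) = P * diagonal (c * c') * P⁻¹ := by
  rw [show P * diagonal c * P⁻¹ * (P * diagonal c' * P⁻¹) = P * diagonal c * (P⁻¹ * P) * diagonal c' * P⁻¹ by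
    simp only [Matrix.mul_assoc], Matrix.nonsing_inv_mul _ hP, Matrix.mul_one, Matrix.mul_assoc P (diagonal c),
    diagonal_mul_diagonal]
  rfl

/-- The frame coordinates are unique: `P diag(c) P⁻¹ = P diag(c') P⁻¹ ⟹ c = c'`. [folklore] -/
private theorem conjDiag_injective₅₃ (hP : IsUnit P.det) {c c' : ι → ℂ}
    (h : P * diagonal c * P⁻¹ = P * diagonal c' * P⁻¹) : c = c' := by
  have h' := congrArg (fun X ↦ P⁻¹ * X * P) h
  simp only [inv_mul_conj_mul₅₃ hP] at h'
  exact diagonal_injective h'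

omit [Fintype ι] [DecidableEq ι] in
/-- `σ⁻¹(σ(M)) = M` entrywise. [folklore] -/
private theorem map_ringEquiv_map_symm₅₃ (σ : ℂ ≃+* ℂ) (M : Matrix ι ι ℂ) : (M.map σ).map σ.symm = M := by
  ext i j
  simp [Matrix.map_apply]

omit [Fintype ι] [DecidableEq ι] in
/-- `σ(c • M) = σ(c) • σ(M)`. [folklore] -/
private theorem map_smul_ringEquiv₅₃ (σ : ℂ ≃+* ℂ) (c : ℂ) (M : Matrix ι ι ℂ) :
    (c • M).map σ = σ c • M.map σ := by
  ext i j
  simp [Matrix.map_apply]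

omit [Fintype ι] [DecidableEq ι] in
/-- An element with `x² = x` is `0` or `1`. [folklore] -/
private theorem eq_zero_or_eq_one_of_mul_self₅₃ {x : ℂ} (h : x * x = x) : x = 0 ∨ x = 1 := by
  have h' : x * (x - 1) = 0 := by rw [mul_sub, mul_one, h, sub_self]
  rcases mul_eq_zero.1 h' with h0 | h1
  · exact Or.inl h0
  · exact Or.inr (sub_eq_zero.1 h1)

end Plumbing

/-! ### §1 `Aut(ℂ)` permutes the eigenlines of a `σ`-stable split commutative algebra `{P diag(c) P⁻¹}` -/

section FramePermutation

variable {ι : Type*} [Fintype ι] [DecidableEq ι] {P : Matrix ι ι ℂ}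

/-- **`Aut(ℂ)` ACTS ON A STABLE SPLIT TORUS ALGEBRA BY PERMUTING ITS EIGENLINES.**  Let `P ∈ GL_ι(ℂ)` and suppose the
entrywise action of `σ ∈ Aut(ℂ)` carries the commutative algebra `𝒯 = {P diag(c) P⁻¹ | c : ι → ℂ} ≅ ℂ^ι` into itself (as it
does when `𝒯 = T ⊗ ℂ` for a rational `T`).  Then there is a permutation `g` of `ι` with
`σ(P diag(z) P⁻¹) = P diag(σ ∘ z ∘ g) P⁻¹` for every `z` — the induced ring automorphism of `ℂ^ι` is `σ`-semilinear and permutes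
the minimal idempotents `e_j` (this is the `Γ`-action on the (co)characters of a torus defined over `ℚ`, read in a split frame).
[cite: Borel1991, §8.11 (the `Γ`-module `X*(T)` of an `F`-torus) and AG §14.3] [cite: Springer1998, 13.1.1 and 3.2.10 (4)] -/
theorem exists_perm_forall_map_conj_diagonal (hP : IsUnit P.det) (σ : ℂ ≃+* ℂ)
    (hst : ∀ c : ι → ℂ, ∃ c' : ι → ℂ, (P * diagonal c * P⁻¹).map σ = P * diagonal c' * P⁻¹) :
    ∃ g : Equiv.Perm ι, ∀ z : ι → ℂ, (P * diagonal z * P⁻¹).map σ = P * diagonal (fun j ↦ σ (z (g j))) * P⁻¹ := by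
  classical
  choose τ hτ using hst
  have inj : ∀ {a b : ι → ℂ}, P * diagonal a * P⁻¹ = P * diagonal b * P⁻¹ → a = b := conjDiag_injective₅₃ hP
  -- `τ` is a `σ`-semilinear injective ring endomorphism of `ℂ^ι`
  have τ_mul : ∀ a b, τ (a * b) = τ a * τ b := fun a b ↦ by
    apply inj
    rw [← hτ, ← conjDiag_mul₅₃ hP, Matrix.map_mul, hτ, hτ, conjDiag_mul₅₃ hP]
  have hdadd : ∀ a b : ι → ℂ, diagonal (a + b) = diagonal a + diagonal b := fun a b ↦ (diagonal_add a b).symm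
  have τ_add : ∀ a b, τ (a + b) = τ a + τ b := fun a b ↦ by
    apply inj
    rw [← hτ, hdadd, Matrix.mul_add, Matrix.add_mul, Matrix.map_add _ (map_add σ), hτ, hτ, hdadd,
      Matrix.mul_add, Matrix.add_mul]
  have τ_smul : ∀ (c : ℂ) (a : ι → ℂ), τ (c • a) = σ c • τ a := fun c a ↦ by
    apply inj
    rw [← hτ, diagonal_smul, Matrix.mul_smul, Matrix.smul_mul, map_smul_ringEquiv₅₃, hτ, diagonal_smul,
      Matrix.mul_smul, Matrix.smul_mul]
  have hd1 : diagonal (1 : ι → ℂ) = (1 : Matrix ι ι ℂ) := diagonal_one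
  have τ_one : τ 1 = 1 := by
    apply inj
    rw [← hτ, hd1, Matrix.mul_one, Matrix.mul_nonsing_inv _ hP, Matrix.map_one _ (map_zero σ) (map_one σ)]
  have τ_zero : τ 0 = 0 := by
    have h := τ_add 0 0
    rw [add_zero] at h
    simpa using h
  have τ_inj : ∀ {a b}, τ a = τ b → a = b := fun {a b} h ↦ by
    have h' : (P * diagonal a * P⁻¹).map (σ : ℂ → ℂ) = (P * diagonal b * P⁻¹).map σ := by rw [hτ, hτ, h]
    have h'' := congrArg (fun M : Matrix ι ι ℂ ↦ M.map (σ.symm : ℂ → ℂ)) h'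
    simp only [map_ringEquiv_map_symm₅₃] at h''
    exact inj h''
  obtain ⟨τ', hτ'⟩ : ∃ τ' : (ι → ℂ) →+ (ι → ℂ), ∀ a, τ' a = τ a :=
    ⟨{ toFun := τ, map_zero' := τ_zero, map_add' := τ_add }, fun _ ↦ rfl⟩
  -- the images `d j = τ(e_j)` of the minimal idempotents
  obtain ⟨d, hd⟩ : ∃ d : ι → ι → ℂ, ∀ j, d j = τ (Pi.single j 1) := ⟨_, fun _ ↦ rfl⟩
  have hd01 : ∀ j i, d j i = 0 ∨ d j i = 1 := fun j i ↦ by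
    apply eq_zero_or_eq_one_of_mul_self₅₃
    have h := τ_mul (Pi.single j 1) (Pi.single j 1)
    rw [← Pi.single_mul, mul_one, ← hd] at h
    exact (congrFun h i).symm
  have hdorth : ∀ j k, j ≠ k → ∀ i, d j i * d k i = 0 := fun j k hjk i ↦ by
    have h := τ_mul (Pi.single j 1) (Pi.single k 1)
    have h0 : (Pi.single j (1 : ℂ) : ι → ℂ) * Pi.single k 1 = 0 := by
      funext x
      rw [Pi.mul_apply, Pi.zero_apply, Pi.single_apply, Pi.single_apply]
      by_cases hx : x = j
      · subst hx; simp [hjk]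
      · simp [hx]
    rw [h0, τ_zero, ← hd, ← hd] at h
    exact (congrFun h i).symm
  have hdsum : ∀ i, ∑ j, d j i = 1 := fun i ↦ by
    have h1 : ∑ j, (Pi.single j (1 : ℂ) : ι → ℂ) = 1 := by
      funext x
      simp [Finset.sum_apply, Pi.single_apply]
    have h : ∑ j, d j = 1 := by
      have e1 : ∑ j, d j = ∑ j, τ' (Pi.single j 1) := Finset.sum_congr rfl fun j _ ↦ by rw [hd, hτ']
      rw [e1, ← map_sum, h1, hτ', τ_one]
    have := congrFun h i
    rwa [Finset.sum_apply] at this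
  have hdne : ∀ j, d j ≠ 0 := fun j h ↦ by
    rw [hd] at h
    have h1 : (Pi.single j (1 : ℂ) : ι → ℂ) = 0 := τ_inj (h.trans τ_zero.symm)
    have h2 : (Pi.single j (1 : ℂ) : ι → ℂ) j = 0 := by rw [h1, Pi.zero_apply]
    rw [Pi.single_eq_same] at h2
    exact one_ne_zero h2
  -- each coordinate `i` carries exactly one `d j`
  have hex : ∀ i, ∃ j, d j i = 1 := fun i ↦ by
    by_contra h
    push Not at h
    have h0 : ∀ j, d j i = 0 := fun j ↦ (hd01 j i).resolve_right (h j)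
    have := hdsum i
    rw [Finset.sum_eq_zero fun j _ ↦ h0 j] at this
    exact zero_ne_one this
  have huniq : ∀ i j k, d j i = 1 → d k i = 1 → j = k := fun i j k hj hk ↦ by
    by_contra hjk
    have := hdorth j k hjk i
    rw [hj, hk, mul_one] at this
    exact one_ne_zero this
  choose f hf using hex
  have hfiff : ∀ i j, d j i = 1 ↔ f i = j := fun i j ↦ ⟨fun h ↦ huniq i _ _ (hf i) h, fun h ↦ h ▸ hf i⟩
  have hsurj : Surjective f := fun j ↦ by
    obtain ⟨i, hi⟩ : ∃ i, d j i ≠ 0 := by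
      by_contra h
      push Not at h
      exact hdne j (funext h)
    exact ⟨i, (hfiff i j).1 ((hd01 j i).resolve_left hi)⟩
  have hinj : Injective f := Finite.injective_iff_surjective.2 hsurj
  refine ⟨Equiv.ofBijective f ⟨hinj, hsurj⟩, fun z ↦ ?_⟩
  -- `τ z = ∑ⱼ σ(z j) d j = σ ∘ z ∘ f`
  have hz : τ z = fun i ↦ σ (z (f i)) := by
    have hdec : z = ∑ j, z j • (Pi.single j (1 : ℂ) : ι → ℂ) := by
      funext i
      simp [Finset.sum_apply, Pi.single_apply]
    calc τ z = τ (∑ j, z j • (Pi.single j (1 : ℂ) : ι → ℂ)) := by rw [← hdec]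
      _ = τ' (∑ j, z j • (Pi.single j (1 : ℂ) : ι → ℂ)) := (hτ' _).symm
      _ = ∑ j, τ' (z j • (Pi.single j (1 : ℂ) : ι → ℂ)) := map_sum τ' _ _
      _ = ∑ j, σ (z j) • d j := Finset.sum_congr rfl fun j _ ↦ by rw [hτ', τ_smul, hd]
      _ = fun i ↦ σ (z (f i)) := by
          funext i
          rw [Finset.sum_apply, Finset.sum_eq_single (f i)]
          · rw [Pi.smul_apply, smul_eq_mul, hf i, mul_one]
          · intro j _ hj
            rw [Pi.smul_apply, smul_eq_mul, (hd01 j i).resolve_right (fun h ↦ hj ((hfiff i j).1 h).symm), mul_zero]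
          · intro h
            exact absurd (Finset.mem_univ _) h
  rw [hτ, hz]
  rfl

end FramePermutation

/-! ### §2 Quartic CM data: some automorphism of `ℂ` induces a 4-cycle on the four embeddings (MZ (4.1)) -/

section FourCycle

variable {ι : Type*} [Fintype ι] [DecidableEq ι] {K : Type} [Field K] [NumberField K]

/-- **THE 4-CYCLE (Moonen–Zarhin 1999 §4 (4.1), read on embeddings).**  Let `χ_j` (`j ∈ ι`, `#ι = 4`) be an injective family
of complex embeddings of a number field `K` carrying a «complex conjugation» `τ ≠ id` (`χ_j ∘ τ = conj ∘ χ_j`), paired by an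
involution `π` (`χ_{π j} = conj ∘ χ_j`), such that every automorphism `σ` of `ℂ` PERMUTES the `χ_j` (`σ ∘ χ_{g j} = χ_j`), and
suppose `K` contains no element of negative rational square («`F` does not contain an imaginary quadratic subfield»).  Then
for every CM type `{j₁, j₂}` (`j₂ ≠ j₁, π j₁`) some `σ ∈ Aut(ℂ)` induces the 4-CYCLE `j₁ ↦ j₂ ↦ π j₁` or `j₂ ↦ j₁ ↦ π j₂`
(«either `F` is Galois over `ℚ`, in which case `Aut(F)` is cyclic of order 4 acting transitively on `Γ_F`, or … its normal
closure `L` has degree 8», `Gal(L/ℚ) ≅ D₄` — in both cases an element of order 4 acts; were there none, the induced permutations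
would form the Klein four-group `{e, π, κ, πκ}` and `χ_{j₁}(a - τa) ± χ_{j₂}(a - τa)` would be an element of `χ_{j₁}(K)` of
negative rational square).  [cite: MoonenZarhin1999LowDim, §4 (4.1) (p0008 L1–L7) and proof of Prop. (4.2) (p0008 L16–L29)]
[cite: Shimura1998, §8.4 Prop. 14 and Prop. 18 (as used by Moonen–Zarhin: «the CM-field `F` does not contain an imaginary quadratic field»)] -/
theorem exists_ringEquiv_fourCycle_of_forall_sq_ne (hcard : Fintype.card ι = 4)
    (χ : ι → (K →+* ℂ)) (hχ : Injective χ) {π : ι → ι} (hπi : Involutive π)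
    (hπc : ∀ j x, χ (π j) x = conj (χ j x)) {τ : K → K} (hτ : ∀ j x, χ j (τ x) = conj (χ j x))
    (hτne : ∃ a, τ a ≠ a) (hnq : ∀ (w : K) (r : ℚ), r < 0 → w ^ 2 ≠ algebraMap ℚ K r)
    (hperm : ∀ σ : ℂ ≃+* ℂ, ∃ g : Equiv.Perm ι, ∀ j x, σ (χ (g j) x) = χ j x)
    {j₁ j₂ : ι} (h12 : j₁ ≠ j₂) (h12' : j₂ ≠ π j₁) :
    ∃ (σ : ℂ ≃+* ℂ) (g : Equiv.Perm ι), (∀ j x, σ (χ (g j) x) = χ j x) ∧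
      (g j₁ = j₂ ∧ g j₂ = π j₁ ∨ g j₂ = j₁ ∧ g j₁ = π j₂) := by
  classical
  obtain ⟨a, ha⟩ := hτne
  -- `π` has no fixed points (`τ ≠ id`)
  have hπ' : ∀ j, π j ≠ j := fun j hj ↦ ha ((χ j).injective (by rw [hτ, ← hπc, hj]))
  obtain ⟨⟨h3, h5⟩, hex⟩ := four_points₅₃ hcard hπi hπ' h12 h12'
  have h2' : π j₁ ≠ j₂ := fun h ↦ h12' h.symm
  -- (U) the index with prescribed values, (C) the permutations commute with `π`
  have U : ∀ (σ : ℂ ≃+* ℂ) (g : Equiv.Perm ι) (j k : ι), (∀ j x, σ (χ (g j) x) = χ j x) →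
      (∀ x, σ (χ k x) = χ j x) → g j = k := fun σ g j k hg hk ↦
    hχ (RingHom.ext fun x ↦ σ.injective (by rw [hg, hk]))
  have C : ∀ (σ : ℂ ≃+* ℂ) (g : Equiv.Perm ι), (∀ j x, σ (χ (g j) x) = χ j x) → ∀ j, g (π j) = π (g j) :=
    fun σ g hg j ↦ U σ g (π j) (π (g j)) hg fun x ↦ by rw [hπc, ← hτ, hg, hτ, hπc]
  -- transitivity: `σ₀ ∘ χ_{j₂} = χ_{j₁}`
  have hℂ : ℵ₀ < #ℂ := by
    rw [Cardinal.mk_complex]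
    exact Cardinal.aleph0_lt_continuum
  haveI : Countable K := Finsupp.Countable.of_moduleFinite (R := ℚ) (M := K)
  have hK : #K ≤ ℵ₀ := Cardinal.mk_le_aleph0_iff.2 inferInstance
  obtain ⟨σ₀, hσ₀⟩ := exists_ringEquiv_apply_eq hℂ hK (χ j₂) (χ j₁)
  obtain ⟨g₀, hg₀⟩ := hperm σ₀
  have hg₀1 : g₀ j₁ = j₂ := U σ₀ g₀ j₁ j₂ hg₀ hσ₀
  -- composites
  have comp : ∀ (σ : ℂ ≃+* ℂ) (g : Equiv.Perm ι), (∀ j x, σ (χ (g j) x) = χ j x) →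
      ∀ j x, (σ.trans σ₀) (χ ((g * g₀) j) x) = χ j x := fun σ g hg j x ↦ by
    rw [RingEquiv.trans_apply, Equiv.Perm.mul_apply, hg, hg₀]
  by_contra H
  have H' : ∀ (σ : ℂ ≃+* ℂ) (g : Equiv.Perm ι), (∀ j x, σ (χ (g j) x) = χ j x) →
      (g j₁ = j₂ → g j₂ ≠ π j₁) ∧ (g j₂ = j₁ → g j₁ ≠ π j₂) := fun σ g hg ↦
    ⟨fun h1 h2 ↦ H ⟨σ, g, hg, Or.inl ⟨h1, h2⟩⟩, fun h1 h2 ↦ H ⟨σ, g, hg, Or.inr ⟨h1, h2⟩⟩⟩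
  -- `g₀` is the swap `κ = (j₁ j₂)(π j₁ π j₂)`
  have hg₀2 : g₀ j₂ = j₁ := by
    rcases hex (g₀ j₂) with h | h | h | h
    · exact h
    · exact absurd (g₀.injective (h.trans hg₀1.symm)) h12.symm
    · exact absurd h ((H' σ₀ g₀ hg₀).1 hg₀1)
    · have h' : g₀ (π j₂) = g₀ j₁ := by rw [C σ₀ g₀ hg₀, h, hπi j₂, hg₀1]
      exact absurd (g₀.injective h') h3
  -- the Klein four-group: every induced permutation is `e`, `π`, `κ` or `πκ`
  have KL : ∀ (σ : ℂ ≃+* ℂ) (g : Equiv.Perm ι), (∀ j x, σ (χ (g j) x) = χ j x) →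
      (g j₁ = j₁ ∧ g j₂ = j₂) ∨ (g j₁ = π j₁ ∧ g j₂ = π j₂) ∨ (g j₁ = j₂ ∧ g j₂ = j₁) ∨
        (g j₁ = π j₂ ∧ g j₂ = π j₁) := by
    intro σ g hg
    have hC := C σ g hg
    have hH := H' σ g hg
    have hH2 := H' _ _ (comp σ g hg)
    simp only [Equiv.Perm.mul_apply, hg₀1, hg₀2] at hH2
    rcases hex (g j₁) with h1 | h1 | h1 | h1 <;> rcases hex (g j₂) with h2 | h2 | h2 | h2
    · exact absurd (g.injective (h2.trans h1.symm)) h12.symm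
    · exact Or.inl ⟨h1, h2⟩
    · have h' : g (π j₁) = g j₂ := by rw [hC, h1, h2]
      exact absurd (g.injective h') h2'
    · exact absurd h2 (hH2.2 h1)
    · exact Or.inr (Or.inr (Or.inl ⟨h1, h2⟩))
    · exact absurd (g.injective (h2.trans h1.symm)) h12.symm
    · exact absurd h2 (hH.1 h1)
    · have h' : g (π j₂) = g j₁ := by rw [hC, h2, hπi j₂, h1]
      exact absurd (g.injective h') h3
    · have h' : g (π j₂) = g j₁ := by rw [hC, h2, h1]
      exact absurd (g.injective h') h3
    · exact absurd h1 (hH2.1 h2)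
    · exact absurd (g.injective (h2.trans h1.symm)) h12.symm
    · exact Or.inr (Or.inl ⟨h1, h2⟩)
    · exact absurd h1 (hH.2 h2)
    · have h' : g (π j₂) = g j₁ := by rw [hC, h2, h1]
      exact absurd (g.injective h') h3
    · exact Or.inr (Or.inr (Or.inr ⟨h1, h2⟩))
    · exact absurd (g.injective (h2.trans h1.symm)) h12.symm
  -- `χ_{j₂}(K) ⊆ χ_{j₁}(K)` (Galois correspondence for `Aut(ℂ/χ_{j₁}(K))`)
  have hF : #((χ j₁).fieldRange) ≤ ℵ₀ := by
    rw [Cardinal.mk_le_aleph0_iff]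
    exact (Set.countable_range (χ j₁)).to_subtype
  have hlift : ∀ x, ∃ x', χ j₁ x' = χ j₂ x := fun x ↦ by
    refine RingHom.mem_fieldRange.1 (Complex.mem_subfield_of_forall_ringEquiv _ hF fun σ hσ ↦ ?_)
    obtain ⟨g, hg⟩ := hperm σ
    have hg1 : g j₁ = j₁ := U σ g j₁ j₁ hg fun y ↦ hσ _ (RingHom.mem_fieldRange.2 ⟨y, rfl⟩)
    have hg2 : g j₂ = j₂ := by
      rcases KL σ g hg with h | h | h | h
      · exact h.2
      · exact absurd (hg1.symm.trans h.1) (hπ' j₁).symm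
      · exact absurd (hg1.symm.trans h.1) h12
      · exact absurd (hg1.symm.trans h.1) h3.symm
    have := hg j₂ x
    rwa [hg2] at this
  -- `Aut(ℂ)` fixes `u = χ₁(a) - conj χ₁(a) ± (χ₂(a) - conj χ₂(a))` up to sign
  have hev : ∀ (σ : ℂ ≃+* ℂ) (g : Equiv.Perm ι), (∀ j x, σ (χ (g j) x) = χ j x) →
      ∀ j k, g k = j → σ (χ j a) = χ k a := fun σ g hg j k hk ↦ by rw [← hk]; exact hg k a
  have S : ∀ (σ : ℂ ≃+* ℂ) (ε : ℂ), ε = 1 ∨ ε = -1 →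
      σ (χ j₁ a - conj (χ j₁ a) + ε * (χ j₂ a - conj (χ j₂ a))) =
          χ j₁ a - conj (χ j₁ a) + ε * (χ j₂ a - conj (χ j₂ a)) ∨
        σ (χ j₁ a - conj (χ j₁ a) + ε * (χ j₂ a - conj (χ j₂ a))) =
          -(χ j₁ a - conj (χ j₁ a) + ε * (χ j₂ a - conj (χ j₂ a))) := by
    intro σ ε hε
    obtain ⟨g, hg⟩ := hperm σ
    have hC := C σ g hg
    have hεσ : σ ε = ε := by rcases hε with rfl | rfl <;> simp
    rw [map_add, map_mul, hεσ, map_sub, map_sub, ← hπc, ← hπc]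
    rcases KL σ g hg with ⟨h1, h2⟩ | ⟨h1, h2⟩ | ⟨h1, h2⟩ | ⟨h1, h2⟩
    · left
      rw [hev σ g hg j₁ j₁ h1, hev σ g hg j₂ j₂ h2, hev σ g hg (π j₁) (π j₁) (by rw [hC, h1]),
        hev σ g hg (π j₂) (π j₂) (by rw [hC, h2]), hπc, hπc]
    · right
      rw [hev σ g hg j₁ (π j₁) (by rw [hC, h1, hπi]), hev σ g hg j₂ (π j₂) (by rw [hC, h2, hπi]),
        hev σ g hg (π j₁) j₁ h1, hev σ g hg (π j₂) j₂ h2, hπc, hπc]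
      ring
    · rcases hε with rfl | rfl
      · left
        rw [hev σ g hg j₁ j₂ h2, hev σ g hg j₂ j₁ h1, hev σ g hg (π j₁) (π j₂) (by rw [hC, h2]),
          hev σ g hg (π j₂) (π j₁) (by rw [hC, h1]), hπc, hπc]
        ring
      · right
        rw [hev σ g hg j₁ j₂ h2, hev σ g hg j₂ j₁ h1, hev σ g hg (π j₁) (π j₂) (by rw [hC, h2]),
          hev σ g hg (π j₂) (π j₁) (by rw [hC, h1]), hπc, hπc]
        ring
    · rcases hε with rfl | rfl
      · right
        rw [hev σ g hg j₁ (π j₂) (by rw [hC, h2, hπi]), hev σ g hg j₂ (π j₁) (by rw [hC, h1, hπi]),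
          hev σ g hg (π j₁) j₂ h2, hev σ g hg (π j₂) j₁ h1, hπc, hπc]
        ring
      · left
        rw [hev σ g hg j₁ (π j₂) (by rw [hC, h2, hπi]), hev σ g hg j₂ (π j₁) (by rw [hC, h1, hπi]),
          hev σ g hg (π j₁) j₂ h2, hev σ g hg (π j₂) j₁ h1, hπc, hπc]
        ring
  -- such a `w ≠ 0` in `χ_{j₁}(K)` has negative rational square: contradiction
  have hQ : #((Rat.castHom ℂ).fieldRange) ≤ ℵ₀ := by
    rw [Cardinal.mk_le_aleph0_iff]
    exact (Set.countable_range (Rat.castHom ℂ)).to_subtype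
  have key : ∀ w : ℂ, w ≠ 0 → (∀ σ : ℂ ≃+* ℂ, σ w = w ∨ σ w = -w) → conj w = -w → (∃ b, χ j₁ b = w) → False := by
    intro w hw0 hwσ hwc hwb
    obtain ⟨b, hb⟩ := hwb
    obtain ⟨q, hq⟩ : ∃ q : ℚ, (Rat.castHom ℂ) q = w ^ 2 :=
      RingHom.mem_fieldRange.1 (Complex.mem_subfield_of_forall_ringEquiv _ hQ fun σ _ ↦ by
        rw [map_pow]
        rcases hwσ σ with h | h
        · rw [h]
        · rw [h]
          ring)
    rw [Rat.coe_castHom] at hq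
    have hre : w.re = 0 := by
      have h := congrArg Complex.re hwc
      rw [Complex.conj_re, Complex.neg_re] at h
      linarith
    obtain ⟨y, hy⟩ : ∃ y : ℝ, w = y * Complex.I := ⟨w.im, by apply Complex.ext <;> simp [hre]⟩
    have hy0 : y ≠ 0 := fun h ↦ hw0 (by rw [hy, h]; simp)
    have hq' : (q : ℝ) < 0 := by
      have h : ((q : ℝ) : ℂ) = ((-(y ^ 2) : ℝ) : ℂ) := by
        rw [Complex.ofReal_ratCast, hq, hy, mul_pow, Complex.I_sq]
        push_cast
        ring
      rw [Complex.ofReal_inj.1 h]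
      have : 0 < y ^ 2 := by positivity
      linarith
    have hqneg : q < 0 := by exact_mod_cast hq'
    refine hnq b q hqneg ((χ j₁).injective ?_)
    rw [map_pow, hb, ← hq, eq_ratCast, map_ratCast]
  have hx : χ j₁ a - conj (χ j₁ a) ≠ 0 := by
    rw [← hτ, sub_ne_zero]
    exact fun h ↦ ha ((χ j₁).injective h).symm
  by_cases hu : χ j₁ a - conj (χ j₁ a) + 1 * (χ j₂ a - conj (χ j₂ a)) = 0
  · -- use `v = … - …`
    have hv0 : χ j₁ a - conj (χ j₁ a) + (-1) * (χ j₂ a - conj (χ j₂ a)) ≠ 0 := by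
      intro hv
      apply hx
      linear_combination (hu + hv) / 2
    refine key _ hv0 (fun σ ↦ S σ (-1) (Or.inr rfl)) ?_ ?_
    · rw [map_add, map_mul, map_sub, map_sub, Complex.conj_conj, Complex.conj_conj, map_neg, map_one]
      ring
    · obtain ⟨a', ha'⟩ := hlift (a - τ a)
      refine ⟨(a - τ a) - a', ?_⟩
      rw [map_sub, ha', map_sub, map_sub, hτ, hτ]
      ring
  · refine key _ hu (fun σ ↦ S σ 1 (Or.inl rfl)) ?_ ?_
    · rw [map_add, map_mul, map_sub, map_sub, Complex.conj_conj, Complex.conj_conj, map_one]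
      ring
    · obtain ⟨a', ha'⟩ := hlift (a - τ a)
      refine ⟨(a - τ a) + a', ?_⟩
      rw [map_add, ha', map_sub, map_sub, hτ, hτ]
      ring

end FourCycle


/-! ### §3 The eigenframe of a simple CM surface -/

section Eigenframe

variable {κ : Type} [Fintype κ] [DecidableEq κ] {E : Type} [NormedAddCommGroup E] [NormedSpace ℂ E]
  [FiniteDimensional ℂ E] {Ψ : (κ → ℝ) ≃L[ℝ] E} {η : E [⋀^Fin 2]→L[ℝ] ℝ}

omit [Fintype κ] [DecidableEq κ] in
/-- `A ⊗ 1` with `algebraMap` is `A ⊗ 1` with the cast. [folklore] -/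
private theorem map_algebraMap_eq_map_ratCast₅₃ (A : Matrix κ κ ℚ) : A.map (algebraMap ℚ ℂ) = A.map ((↑) : ℚ → ℂ) := by
  ext i j
  simp [Matrix.map_apply]

omit [Fintype κ] [DecidableEq κ] in
/-- `(A ⊗_ℚ ℝ) ⊗_ℝ ℂ = A ⊗_ℚ ℂ`. [folklore] -/
private theorem map_ratCast_map_ofRealHom₅₃ (A : Matrix κ κ ℚ) :
    (A.map ((↑) : ℚ → ℝ)).map Complex.ofRealHom = A.map (algebraMap ℚ ℂ) := by
  ext i j
  simp [Matrix.map_apply]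

/-- `exp(π i) ≠ 1`: the one-parameter group `t ↦ e^{tw}` is trivial only for `w = 0`. [folklore] -/
private theorem eq_zero_of_forall_exp_mul_eq_one₅₃ {w : ℂ} (h : ∀ t : ℂ, Complex.exp (t * w) = 1) : w = 0 := by
  by_contra hw
  have h1 := h (Real.pi * Complex.I / w)
  rw [div_mul_cancel₀ _ hw, Complex.exp_pi_mul_I] at h1
  norm_num at h1

/-- **THE EIGENFRAME OF A SIMPLE COMPLEX ABELIAN SURFACE WITH COMPLEX MULTIPLICATION.**  Let `Y = E ∕ Ψ(ℤ^κ)` be a simple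
polarised abelian surface with commutative Hodge group.  There are a fixed-point-free involution `π` of `κ` (`#κ = 4`), a frame
`P ∈ GL_κ(ℂ)` (a common eigenbasis of `End⁰(Y) ⊗ ℂ`) and a sign vector `s : κ → {±1}` such that:
(a) `Hg(Y)(ℂ) = P · 𝕋_π · P⁻¹` («`Hg(X) = U_F`», `U_F(ℂ) ≅ ∏_{Φ} ℂ^×`); (b) `P diag(z) P⁻¹ ∈ Lie Hg(Y)(ℂ) ⟺ z_{π j} = -z_j`
for all `j` (`Lie U_F = F⁻ ⊗ ℂ`); (c) every element of `Lie Hg(Y)(ℂ)` is of the form `P diag(z) P⁻¹`; (d) `J ⊗ 1 = P diag(i s) P⁻¹`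
with `s ∘ π = -s` (the CM type `Φ = {s = 1}`); (e) every `σ ∈ Aut(ℂ)` acts on `P diag(z) P⁻¹` through a permutation `g_σ` of
the eigenlines commuting with `π` (`σ(P diag(z) P⁻¹) = P diag(σ ∘ z ∘ g_σ) P⁻¹`; the Galois action on `X_*(U_F)`); (f) SOME `σ`
acts on the CM type as the 4-CYCLE `j₀ ↦ j₀' ↦ π j₀` (`{j₀, j₀'} = Φ`) — because the quartic CM field `End⁰(Y)` of a SIMPLE CM
surface «does not contain an imaginary quadratic subfield», (4.1).
[cite: MoonenZarhin1999LowDim, §2 (2.2) `g = 2` («Type IV(2,1) … `Hg(X) = U_F`»), §4 (4.1) and proof of Prop. (4.2) (p0008 L1–L29)]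
[cite: Shimura1998, §5.1 Prop. 5–6 and Lemma 2] [cite: Borel1991, §8.11] -/
theorem IsSimple.exists_cmEigenframe_of_hodgeGroup_comm_of_finrank_eq_two (hX : IsSimple Ψ) (hη : IsRiemannForm Ψ η)
    (h2 : finrank ℂ E = 2) (hc : ∀ M ∈ hodgeGroup Ψ, ∀ N ∈ hodgeGroup Ψ, M * N = N * M) :
    ∃ (π : κ → κ) (hπ : Involutive π) (hπ' : ∀ j, π j ≠ j) (P : Matrix κ κ ℂ) (hP : IsUnit P.det) (s : κ → ℂ),
      Fintype.card κ = 4 ∧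
      hodgeGroupC Ψ = (pairedDiagTorus hπ hπ').map (conjGLC P hP).toMonoidHom ∧
      (∀ z : κ → ℂ, P * diagonal z * P⁻¹ ∈ lieAlgebraGL ((hodgeGroupC Ψ).map Matrix.SpecialLinearGroup.toGL) ↔
        ∀ j, z (π j) = -z j) ∧
      (∀ Z ∈ lieAlgebraGL ((hodgeGroupC Ψ).map Matrix.SpecialLinearGroup.toGL), ∃ z : κ → ℂ, Z = P * diagonal z * P⁻¹) ∧
      (∀ j, s j = 1 ∨ s j = -1) ∧ (∀ j, s (π j) = -s j) ∧
      (jMatrix Ψ).map Complex.ofRealHom = P * diagonal (fun j ↦ Complex.I * s j) * P⁻¹ ∧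
      (∀ σ : ℂ ≃+* ℂ, ∃ g : Equiv.Perm κ, (∀ j, g (π j) = π (g j)) ∧
        ∀ z : κ → ℂ, (P * diagonal z * P⁻¹).map σ = P * diagonal (fun j ↦ σ (z (g j))) * P⁻¹) ∧
      ∃ (σ : ℂ ≃+* ℂ) (g : Equiv.Perm κ) (j₀ j₀' : κ),
        (∀ z : κ → ℂ, (P * diagonal z * P⁻¹).map σ = P * diagonal (fun j ↦ σ (z (g j))) * P⁻¹) ∧
        (∀ j, g (π j) = π (g j)) ∧ j₀ ≠ j₀' ∧ s j₀ = 1 ∧ s j₀' = 1 ∧ g j₀ = j₀' ∧ g j₀' = π j₀ := by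
  classical
  have hcard : Fintype.card κ = 4 := by rw [card_eq_two_mul_finrank Ψ, h2]
  haveI : Nonempty κ := Fintype.card_pos_iff.1 (by omega)
  haveI : IsReduced (endAlgRat Ψ) := by letI := hX.divisionRing; infer_instance
  obtain ⟨G, hG⟩ := hη.exists_ratMatrix_latticeGram
  obtain ⟨hcomm, h4⟩ := hX.endAlgRat_comm_and_finrank_eq_four_of_hodgeGroup_comm_of_finrank_eq_two hη h2 hc
  have hdim : finrank ℚ (endAlgRat Ψ) = Fintype.card κ := h4.trans hcard.symm
  have hGu : IsUnit G.det := isUnit_det_of_map_ratCast hG hη.isUnit_det_latticeGram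
  have hGt : Gᵀ = -G := transpose_eq_neg_of_map_ratCast Ψ hG
  have hEnd : ∀ A ∈ endAlgRat Ψ, rosati G A ∈ endAlgRat Ψ := fun A hA ↦ rosati_mem_endAlgRat Ψ hη.1 hη.2.2 hG hA
  obtain ⟨π, hπ, hπ', P, hP, hT, hS⟩ := exists_lefschetzGroupC_eq_map_pairedDiagTorus Ψ hcomm hdim hGt hGu hEnd
  have hHgS : hodgeGroupC Ψ = lefschetzGroupC Ψ G :=
    hX.hodgeGroupC_eq_lefschetzGroupC_of_endAlgRat_comm_of_finrank_eq_two hη hG h2 hcomm h4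
  have hHg : hodgeGroupC Ψ = (pairedDiagTorus hπ hπ').map (conjGLC P hP).toMonoidHom := by rw [hHgS, hS]
  -- the algebra `𝒯 = End⁰(Y) ⊗ ℂ = {P diag(c) P⁻¹}`
  set 𝒯 := Submodule.span ℂ ((fun B : Matrix κ κ ℚ ↦ B.map (algebraMap ℚ ℂ)) '' (endAlgRat Ψ : Set (Matrix κ κ ℚ)))
    with h𝒯
  have hspan : ∀ c : κ → ℂ, P * diagonal c * P⁻¹ ∈ 𝒯 := conj_diagonal_mem_span_of_forall (endAlgRat Ψ) hcomm hdim hP hT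
  have hform : ∀ X ∈ 𝒯, ∃ c : κ → ℂ, X = P * diagonal c * P⁻¹ := fun X hX ↦
    exists_eq_conj_diagonal_of_mem_span (endAlgRat Ψ) hP hT hX
  have halg := isAlgebraicSubgroup_map_toGL_hodgeGroupC Ψ
  -- membership of group elements `P diag(d) P⁻¹`
  have hmemHg : ∀ {M : SpecialLinearGroup κ ℂ}, M ∈ hodgeGroupC Ψ ↔
      ∃ d : κ → ℂ, (∀ j, d (π j) * d j = 1) ∧ (M : Matrix κ κ ℂ) = P * diagonal d * P⁻¹ := by
    intro M
    rw [hHg, Subgroup.mem_map_equiv, mem_pairedDiagTorus_iff, coe_conjGLC_symm]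
    constructor
    · rintro ⟨d, hd, hM⟩
      exact ⟨d, hd, by rw [← mul_inv_conj_inv₅₃ hP (M : Matrix κ κ ℂ), hM]⟩
    · rintro ⟨d, hd, hM⟩
      exact ⟨d, hd, by rw [hM, inv_mul_conj_mul₅₃ hP]⟩
  -- (c) every element of `Lie Hg(Y)(ℂ)` lies in `𝒯`
  have hLieform : ∀ Z ∈ lieAlgebraGL ((hodgeGroupC Ψ).map Matrix.SpecialLinearGroup.toGL),
      ∃ z : κ → ℂ, Z = P * diagonal z * P⁻¹ := fun Z hZ ↦ by
    have hZ' : Z ∈ hodgeGroupLieC Ψ := (mem_hodgeGroupLieC_iff_mem_lieAlgebraGL Ψ).2 hZ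
    refine hform Z (mem_span_of_forall_map_mul_comm (endAlgRat Ψ) hcomm hdim fun t ht ↦ ?_)
    rw [map_algebraMap_eq_map_ratCast₅₃]
    exact map_ratCast_comm_of_mem_endAlgRat_of_mem_hodgeGroupLieC ht hZ'
  -- `exp` of a conjugated diagonal
  have hPu : IsUnit P := (Matrix.isUnit_iff_isUnit_det P).2 hP
  have hexp : ∀ (t : ℂ) (z : κ → ℂ), NormedSpace.exp (t • (P * diagonal z * P⁻¹)) =
      P * diagonal (fun j ↦ Complex.exp (t * z j)) * P⁻¹ := fun t z ↦ by
    rw [← exp_smul_diagonal, ← Matrix.exp_conj P (t • diagonal z) hPu, Matrix.mul_smul, Matrix.smul_mul]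
  -- (b) `P diag(z) P⁻¹ ∈ Lie Hg(Y)(ℂ) ⟺ z ∘ π = -z`
  have hLie : ∀ z : κ → ℂ, P * diagonal z * P⁻¹ ∈ lieAlgebraGL ((hodgeGroupC Ψ).map Matrix.SpecialLinearGroup.toGL) ↔
      ∀ j, z (π j) = -z j := by
    intro z
    constructor
    · intro hz j
      rw [eq_neg_iff_add_eq_zero]
      apply eq_zero_of_forall_exp_mul_eq_one₅₃
      intro t
      obtain ⟨g, hg, hgt⟩ := exists_mem_coe_eq_exp_smul_of_mem_lieAlgebraGL halg hz t
      obtain ⟨M, hM, rfl⟩ := Subgroup.mem_map.1 hg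
      obtain ⟨d, hd, hMd⟩ := hmemHg.1 hM
      rw [Matrix.SpecialLinearGroup.coe_GL_coe_matrix, hMd, hexp] at hgt
      have hdz : ∀ k, d k = Complex.exp (t * z k) := fun k ↦ congrFun (conjDiag_injective₅₃ hP hgt) k
      have h := hd j
      rw [hdz, hdz, ← Complex.exp_add, ← mul_add] at h
      exact h
    · intro hz
      refine mem_lieAlgebraGL_of_forall_exp_smul_mem halg fun t ↦ ?_
      have hd : ∀ j, Complex.exp (t * z (π j)) * Complex.exp (t * z j) = 1 := fun j ↦ by
        rw [← Complex.exp_add, hz j, mul_neg, neg_add_cancel, Complex.exp_zero]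
      refine ⟨Matrix.SpecialLinearGroup.toGL (conjGLC P hP (pairedDiag hπ hπ' (fun j ↦ Complex.exp (t * z j)) hd)),
        Subgroup.mem_map_of_mem _ ?_, ?_⟩
      · rw [hHg]
        exact Subgroup.mem_map_of_mem _ (pairedDiag_mem hπ hπ' (fun j ↦ Complex.exp (t * z j)) hd)
      · rw [Matrix.SpecialLinearGroup.coe_GL_coe_matrix, coe_conjGLC, coe_pairedDiag, hexp]
  -- (d) `J ⊗ 1 = P diag(c) P⁻¹` with `c = i s`, `s = ±1`, `s ∘ π = -s`
  have hJmem : (jMatrix Ψ).map Complex.ofRealHom ∈ 𝒯 := by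
    refine mem_span_of_forall_map_mul_comm (endAlgRat Ψ) hcomm hdim fun t ht ↦ ?_
    have h := (mem_endAlgRat_iff Ψ t).1 ht
    have h' := congrArg (fun X : Matrix κ κ ℝ ↦ X.map Complex.ofRealHom) h
    simp only [Matrix.map_mul, map_ratCast_map_ofRealHom₅₃] at h'
    exact h'
  obtain ⟨c, hJc⟩ := hform _ hJmem
  have hJLie : (jMatrix Ψ).map Complex.ofRealHom ∈ lieAlgebraGL ((hodgeGroupC Ψ).map Matrix.SpecialLinearGroup.toGL) :=
    (mem_hodgeGroupLieC_iff_mem_lieAlgebraGL Ψ).1 (jMatrix_map_mem_hodgeGroupLieC Ψ)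
  have hcπ : ∀ j, c (π j) = -c j := (hLie c).1 (hJc ▸ hJLie)
  have hc2 : ∀ j, c j * c j = -1 := fun j ↦ by
    have h : (jMatrix Ψ).map Complex.ofRealHom * (jMatrix Ψ).map Complex.ofRealHom = -1 :=
      map_ofRealHom_mul_self_of_mul_self (jMatrix_mul_jMatrix Ψ)
    rw [hJc, conjDiag_mul₅₃ hP] at h
    have h1 : diagonal (c * c) = -1 := by
      rw [← inv_mul_conj_mul₅₃ hP (diagonal (c * c)), h, Matrix.mul_neg, Matrix.mul_one, Matrix.neg_mul,
        Matrix.nonsing_inv_mul _ hP]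
    have h2 := congrFun (congrFun h1 j) j
    rw [diagonal_apply_eq, Matrix.neg_apply, Matrix.one_apply_eq] at h2
    exact h2
  obtain ⟨s, hs⟩ : ∃ s : κ → ℂ, ∀ j, s j = -Complex.I * c j := ⟨_, fun _ ↦ rfl⟩
  have hsc : ∀ j, c j = Complex.I * s j := fun j ↦ by
    rw [hs]
    linear_combination (c j) * Complex.I_sq
  have hs1 : ∀ j, s j = 1 ∨ s j = -1 := fun j ↦ by
    have h : (s j - 1) * (s j + 1) = 0 := by
      have h2 := hc2 j
      rw [hsc] at h2
      linear_combination (-1 : ℂ) * h2 + (s j) ^ 2 * Complex.I_sq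
    rcases mul_eq_zero.1 h with h | h
    · exact Or.inl (sub_eq_zero.1 h)
    · exact Or.inr (eq_neg_of_add_eq_zero_left h)
  have hsπ : ∀ j, s (π j) = -s j := fun j ↦ by
    rw [hs, hs, hcπ]
    ring
  -- (e) every `σ` permutes the eigenlines, compatibly with `π`
  have hAut : ∀ (σ : ℂ ≃+* ℂ) {Z : Matrix κ κ ℂ}, Z ∈ lieAlgebraGL ((hodgeGroupC Ψ).map Matrix.SpecialLinearGroup.toGL) →
      Z.map σ ∈ lieAlgebraGL ((hodgeGroupC Ψ).map Matrix.SpecialLinearGroup.toGL) := fun σ Z hZ ↦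
    map_mem_lieAlgebraGL_of_forall_map_mem (isAutStableGL_map_toGL_hodgeGroupC Ψ).map_mem σ hZ
  have hperm : ∀ σ : ℂ ≃+* ℂ, ∃ g : Equiv.Perm κ, (∀ j, g (π j) = π (g j)) ∧
      ∀ z : κ → ℂ, (P * diagonal z * P⁻¹).map σ = P * diagonal (fun j ↦ σ (z (g j))) * P⁻¹ := by
    intro σ
    obtain ⟨g, hg⟩ := exists_perm_forall_map_conj_diagonal hP σ fun c ↦
      hform _ (map_ringEquiv_mem_span₅₃ σ _ (hspan c))
    refine ⟨g, fun j' ↦ ?_, hg⟩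
    -- the antisymmetric vector `z = e_{g j'} - e_{π g j'}` is carried to the antisymmetric vector `z ∘ g`
    obtain ⟨z, hz⟩ : ∃ z : κ → ℂ, ∀ k, z k = if k = g j' then 1 else if k = π (g j') then -1 else 0 :=
      ⟨_, fun _ ↦ rfl⟩
    have hzπ : ∀ k, z (π k) = -z k := fun k ↦ by
      by_cases h1 : k = g j'
      · rw [h1]
        simp [hz, hπ' (g j')]
      · by_cases h2 : k = π (g j')
        · rw [h2, hπ (g j')]
          simp [hz, hπ' (g j')]
        · have h3 : π k ≠ g j' := fun h ↦ h2 (by rw [← h, hπ k])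
          have h4 : π k ≠ π (g j') := fun h ↦ h1 (hπ.injective h)
          simp [hz, h1, h2, h3, h4]
    have hzσ : ∀ k, σ (z k) = z k := fun k ↦ by
      rw [hz]
      split_ifs <;> simp
    have hmem := hAut σ ((hLie z).2 hzπ)
    rw [hg] at hmem
    simp only [hzσ] at hmem
    have h : z (g (π j')) = -z (g j') := (hLie _).1 hmem j'
    have hgj : z (g j') = 1 := by simp [hz]
    rw [hgj] at h
    by_contra hne
    have hne' : g (π j') ≠ g j' := fun h' ↦ hπ' j' (g.injective h')
    rw [hz, if_neg hne', if_neg hne] at h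
    norm_num at h
  -- (f) the characters `χ_j : F → ℂ` of the centre field `F = End⁰(Y)` (`A ⊗ 1 = P diag(χ_•(A)) P⁻¹`)
  choose cw hcw using fun w : centerField Ψ hX ↦ hT (centerField.val Ψ hX w) (centerField.val_mem Ψ hX w)
  have cw_mul : ∀ w w', cw (w * w') = cw w * cw w' := fun w w' ↦ by
    apply conjDiag_injective₅₃ hP
    rw [← hcw, map_mul, Matrix.map_mul, hcw, hcw, conjDiag_mul₅₃ hP]
  have cw_add : ∀ w w', cw (w + w') = cw w + cw w' := fun w w' ↦ by
    apply conjDiag_injective₅₃ hP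
    rw [← hcw, map_add, Matrix.map_add _ (map_add _), hcw, hcw,
      show diagonal (cw w + cw w') = diagonal (cw w) + diagonal (cw w') from (diagonal_add _ _).symm, Matrix.mul_add,
      Matrix.add_mul]
  have cw_one : cw 1 = 1 := by
    apply conjDiag_injective₅₃ hP
    rw [← hcw, map_one, Matrix.map_one _ (map_zero _) (map_one _), diagonal_one', Matrix.mul_one,
      Matrix.mul_nonsing_inv _ hP]
  have cw_zero : cw 0 = 0 := by
    have h := cw_add 0 0
    rw [add_zero, left_eq_add] at h
    exact h
  obtain ⟨χ, hχ⟩ : ∃ χ : κ → (centerField Ψ hX →+* ℂ), ∀ j w, χ j w = cw w j :=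
    ⟨fun j ↦
      { toFun := fun w ↦ cw w j
        map_one' := by rw [cw_one, Pi.one_apply]
        map_mul' := fun w w' ↦ by rw [cw_mul, Pi.mul_apply]
        map_zero' := by rw [cw_zero, Pi.zero_apply]
        map_add' := fun w w' ↦ by rw [cw_add, Pi.add_apply] }, fun _ _ ↦ rfl⟩
  -- every `A ∈ End⁰(Y)` is central (`End⁰(Y)` is commutative), so `A = val w`
  have hval : ∀ A ∈ endAlgRat Ψ, ∃ w : centerField Ψ hX, centerField.val Ψ hX w = A := fun A hA ↦
    centerField.exists_val_eq Ψ hX hA fun B hB ↦ hcomm A hA B hB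
  -- `χ` is injective: `(P⁻¹ X P)_{jj} = (P⁻¹ X P)_{kk}` on `𝒯 ∋ P E_{jj} P⁻¹` is absurd for `j ≠ k`
  have hχinj : Injective χ := fun j k hjk ↦ by
    by_contra hne
    have hjk' : ∀ w, cw w j = cw w k := fun w ↦ by rw [← hχ, ← hχ, hjk]
    have hlin : ∀ X ∈ 𝒯, (P⁻¹ * X * P) j j = (P⁻¹ * X * P) k k := by
      intro X hX𝒯
      induction hX𝒯 using Submodule.span_induction with
      | mem Y hY =>
        obtain ⟨A, hA, rfl⟩ := hY
        obtain ⟨w, hw⟩ := hval A hA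
        dsimp only
        rw [← hw, hcw, inv_mul_conj_mul₅₃ hP, diagonal_apply_eq, diagonal_apply_eq, hjk']
      | zero => simp
      | add Y Y' _ _ hY hY' => simp only [Matrix.mul_add, Matrix.add_mul, Matrix.add_apply, hY, hY']
      | smul a Y _ hY => simp only [Matrix.mul_smul, Matrix.smul_mul, Matrix.smul_apply, hY]
    have h := hlin _ (hspan (Pi.single j 1))
    rw [inv_mul_conj_mul₅₃ hP, diagonal_apply_eq, diagonal_apply_eq, Pi.single_eq_same, Pi.single_eq_of_ne' hne] at h
    exact one_ne_zero h
  -- every `σ ∈ Aut(ℂ)` permutes the characters: `σ ∘ χ_{g j} = χ_j` for the line permutation `g = g_σ` of (e)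
  have hgχ : ∀ (σ : ℂ ≃+* ℂ) (g : Equiv.Perm κ),
      (∀ z : κ → ℂ, (P * diagonal z * P⁻¹).map σ = P * diagonal (fun j ↦ σ (z (g j))) * P⁻¹) →
      ∀ j x, σ (χ (g j) x) = χ j x := fun σ g hg j x ↦ by
    have h := hg (cw x)
    rw [← hcw, map_algebraMap_map_ringEquiv₅₃, hcw] at h
    rw [hχ, hχ]
    exact (congrFun (conjDiag_injective₅₃ hP h) j).symm
  have hpermχ : ∀ σ : ℂ ≃+* ℂ, ∃ g : Equiv.Perm κ, ∀ j x, σ (χ (g j) x) = χ j x := fun σ ↦ by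
    obtain ⟨g, -, hg⟩ := hperm σ
    exact ⟨g, hgχ σ g hg⟩
  -- the Rosati involution restricted to `F`: a `τ` with `(val w)' = val (τ w)`, complex conjugation under every `χ_j`
  obtain ⟨τ, hτ⟩ := exists_linearMap_rosati_algHom_eq (centerField.valAlgHom Ψ hX) (hX.exists_rosati_val_eq hη hG)
  have hτconj : ∀ j w, χ j (τ w) = conj (χ j w) := fun j w ↦
    embedding_rosati_eq_conj Ψ hη.1 hη.2.2 hG (centerField.valAlgHom Ψ hX) (centerField.val_mem Ψ hX) hτ (χ j) w
  -- `τ ≠ id` (`[F : ℚ] = 4 = 2 dim Y`: Deligne's `h(i)* = -h(i)`)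
  have hdeg : finrank ℚ (centerField Ψ hX) = Fintype.card κ := by
    rw [finrank_centerField_eq_of_comm hX fun a b ↦ Subtype.ext (hcomm a.1 a.2 b.1 b.2), hdim]
  have hτne : ∃ a, τ a ≠ a := by
    obtain ⟨a, ha⟩ := exists_rosati_ne_of_finrank_eq_card Ψ hη.1 hη.2.2 hG (centerField.valAlgHom Ψ hX)
      (centerField.val_mem Ψ hX) hdeg
    refine ⟨a, fun h ↦ ha ?_⟩
    rw [hτ, h]
  -- the Gram matrix `H = ᵗP Γ P` in the frame pairs the line `i` with the line `π i` only
  obtain ⟨H, hH_def⟩ : ∃ H : Matrix κ κ ℂ, H = Pᵀ * G.map (algebraMap ℚ ℂ) * P := ⟨_, rfl⟩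
  have hH0 : ∀ i k, k ≠ π i → H i k = 0 := fun i k hik ↦ by
    obtain ⟨d, hd_def⟩ : ∃ d : κ → ℂ, ∀ l, d l = if l = i then 2 else if l = π i then 2⁻¹ else 1 :=
      ⟨_, fun _ ↦ rfl⟩
    have hd : ∀ l, d (π l) * d l = 1 := fun l ↦ by
      by_cases h1 : l = i
      · rw [h1]
        norm_num [hd_def, hπ' i]
      · by_cases h2 : l = π i
        · rw [h2, hπ i]
          norm_num [hd_def, hπ' i]
        · have h3 : π l ≠ i := fun h ↦ h2 (by rw [← h, hπ l])
          have h4 : π l ≠ π i := fun h ↦ h1 (hπ.injective h)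
          simp [hd_def, h1, h2, h3, h4]
    have hM : conjGLC P hP (pairedDiag hπ hπ' d hd) ∈ lefschetzGroupC Ψ G := by
      rw [← hHgS, hHg]
      exact Subgroup.mem_map_of_mem _ (pairedDiag_mem hπ hπ' d hd)
    have hsymp : (P * diagonal d * P⁻¹)ᵀ * G.map (algebraMap ℚ ℂ) * (P * diagonal d * P⁻¹) = G.map (algebraMap ℚ ℂ) :=
      ((mem_lefschetzGroupC_iff Ψ).1 hM).1
    rw [conj_diagonal_symplectic_iff hP, ← hH_def] at hsymp
    have h := congrFun (congrFun hsymp i) k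
    rw [mul_diagonal, diagonal_mul] at h
    have hdi : d i = 2 := by simp [hd_def]
    by_cases hki : k = i
    · rw [hki] at h ⊢
      rw [hdi] at h
      linear_combination h / 3
    · have hdk : d k = 1 := by simp [hd_def, hki, hik]
      rw [hdi, hdk] at h
      linear_combination h
  have hΓu : IsUnit (G.map (algebraMap ℚ ℂ)).det := by
    rw [show G.map (algebraMap ℚ ℂ) = (algebraMap ℚ ℂ).mapMatrix G from rfl, ← RingHom.map_det]
    exact hGu.map _
  -- in the frame the Rosati involution is `diag(c) ↦ diag(c ∘ π)`
  have hRos : ∀ cc : κ → ℂ,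
      rosati (G.map (algebraMap ℚ ℂ)) (P * diagonal cc * P⁻¹) = P * diagonal (cc ∘ π) * P⁻¹ := fun cc ↦ by
    rw [rosati_conj_diagonal_eq_iff hP hΓu cc (cc ∘ π), ← hH_def]
    ext i k
    rw [diagonal_mul, mul_diagonal, Function.comp_apply]
    by_cases hik : k = π i
    · rw [hik, hπ i, mul_comm]
    · rw [hH0 i k hik, mul_zero, zero_mul]
  -- hence `χ_j ∘ τ = χ_{π j}` and `χ_{π j} = conj ∘ χ_j`
  have hcwτ : ∀ w j, cw (τ w) j = cw w (π j) := fun w j ↦ by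
    have h1 : (rosati G (centerField.val Ψ hX w)).map (algebraMap ℚ ℂ) = P * diagonal (cw w ∘ π) * P⁻¹ := by
      rw [rosati_map (algebraMap ℚ ℂ) hGu, hcw, hRos]
    have h2 : rosati G (centerField.val Ψ hX w) = centerField.val Ψ hX (τ w) := hτ w
    rw [h2, hcw] at h1
    exact congrFun (conjDiag_injective₅₃ hP h1) j
  have hπc : ∀ j x, χ (π j) x = conj (χ j x) := fun j x ↦ by
    rw [← hτconj, hχ, hχ, hcwτ]
  -- «`F` does not contain an imaginary quadratic field» (the surface is simple)
  have hnq : ∀ (w : centerField Ψ hX) (r : ℚ), r < 0 → w ^ 2 ≠ algebraMap ℚ (centerField Ψ hX) r :=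
    fun w r hr ↦ hX.sq_ne_algebraMap_of_neg_of_finrank_eq_two hη h2 w hr
  -- the CM type `{j₁, j₂} = {s = 1}`
  obtain ⟨j₁, hj₁⟩ : ∃ j₁, s j₁ = 1 := by
    obtain ⟨j⟩ := ‹Nonempty κ›
    rcases hs1 j with h | h
    · exact ⟨j, h⟩
    · exact ⟨π j, by rw [hsπ, h, neg_neg]⟩
  obtain ⟨j₂, h12, hj₂⟩ : ∃ j₂, j₁ ≠ j₂ ∧ s j₂ = 1 := by
    obtain ⟨k, -, hk⟩ := Finset.exists_mem_notMem_of_card_lt_card (s := ({j₁, π j₁} : Finset κ)) (t := Finset.univ)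
      (lt_of_le_of_lt Finset.card_le_two (by rw [Finset.card_univ, hcard]; norm_num))
    rw [Finset.mem_insert, Finset.mem_singleton, not_or] at hk
    rcases hs1 k with h | h
    · exact ⟨k, Ne.symm hk.1, h⟩
    · refine ⟨π k, fun h' ↦ hk.2 ?_, by rw [hsπ, h, neg_neg]⟩
      rw [h', hπ k]
  have h12' : j₂ ≠ π j₁ := fun h ↦ by
    rw [h, hsπ, hj₁] at hj₂
    norm_num at hj₂
  -- (4.1): some `σ` induces the 4-cycle on the characters, hence on the lines
  obtain ⟨σ, g, hσg, hcyc⟩ :=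
    exists_ringEquiv_fourCycle_of_forall_sq_ne hcard χ hχinj hπ hπc hτconj hτne hnq hpermχ h12 h12'
  obtain ⟨g', hg'π, hg'⟩ := hperm σ
  have hgg : ∀ j, g' j = g j := fun j ↦ hχinj (RingHom.ext fun x ↦ σ.injective (by
    rw [hgχ σ g' hg' j x, hσg j x]))
  have hJ : (jMatrix Ψ).map Complex.ofRealHom = P * diagonal (fun j ↦ Complex.I * s j) * P⁻¹ := by
    rw [hJc, show c = fun j ↦ Complex.I * s j from funext hsc]
  refine ⟨π, hπ, hπ', P, hP, s, hcard, hHg, hLie, hLieform, hs1, hsπ, hJ, hperm, σ, g', ?_⟩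
  rcases hcyc with ⟨hg1, hg2⟩ | ⟨hg2, hg1⟩
  · exact ⟨j₁, j₂, hg', hg'π, h12, hj₁, hj₂, (hgg j₁).trans hg1, (hgg j₂).trans hg2⟩
  · exact ⟨j₂, j₁, hg', hg'π, h12.symm, hj₂, hj₁, (hgg j₂).trans hg2, (hgg j₁).trans hg1⟩

end Eigenframe

end ComplexTorus

end Literature.Geometry.Kaehler
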